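import Literature.AlgebraicGeometry.Resolution.FrobeniusClosedBases
import Mathlib.FieldTheory.IsAlgClosed.Basic
import Mathlib.RingTheory.Valuation.Integral
import Mathlib.Order.Zorn
import Mathlib.Algebra.CharP.Frobenius
import HarnessLib

/-!
# Fields of representatives inside an algebraically closed valued subfield (Kuhlmann 2010, proof of Lemma 4.10)

Topic: `Literature/AlgebraicGeometry/Resolution` (valued function fields). First step of the
proof of F.-V. Kuhlmann, *Elimination of ramification I: The generalized stability theorem*,
Trans. AMS 362 (2010) 5697–5727 = arXiv:1003.5678, **Lemma 4.10** (p. 14 of the arXiv version,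
the case `char K = p` of Lemma 4.7: a subring with a lifting of a Frobenius-closed basis, the
named fact `Kuhlmann2010Lemma410` of `FrobeniusClosedBases.lean`), whose proof begins:

> Since `K` is assumed to be henselian and perfect, it contains a field of representatives for
> the residue field `K̄` (we leave the easy proof to the reader). We identify this field with
> `K̄`, so that we can write `K̄ ⊂ K` with `ā = a` for all `a ∈ K̄`.

This file PROVES that statement in the ambient rendering of the tree (one valued field
`(Ω, V)`, subfields of `Ω` valued by restriction) for an ALGEBRAICALLY CLOSED subfield `K ≤ Ω`
(the case in which `Kuhlmann2010Lemma410` is vendored): there is a subfield `k ≤ K` contained in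
the valuation ring `V` — so that the residue map is injective on `k` — whose residues exhaust
the residue field `K̄ = residueSubfield K V`. The "easy proof": a subfield `k ≤ K` with `k ⊆ V`
which is maximal for inclusion (Zorn) has all of `K̄` as residues — a residue `r` transcendental
over `k̄` lifts to any `a ∈ K` of residue `r`, and `k(a) ⊆ V` by the Gauss bound; a residue `r`
algebraic over `k̄` is the residue of a root `ρ ∈ K` of the lift `g ∈ k[X]` of its minimal
polynomial (`K` is algebraically closed and the roots of the monic `g` lie in `V`), and
`k(ρ) = k[ρ] ⊆ V` because a non-zero `m(ρ)`, `deg m < deg g`, has non-zero residue `m̄(r)`.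

## Content (everything PROVED)

* `aeval_mem_subring` — `P(c) ∈ T` for a subring `T ⊇ k ∪ {c}`.
* `residOn V k hk` — the residue map restricted to a subfield `k ⊆ V`, a ring homomorphism
  `k →+* Ωv`; `residOn_apply`; `resid_aeval` (`P(c)‾ = P̄(c̄)`).
* `adjoin_simple_subset_of_valuation_aeval` — the criterion `k(c) ⊆ V`.
* `exists_subfield_of_representatives` — **the field of representatives** (for `char Ω = p`,
  used to start Zorn's lemma at the prime field, on which the valuation is trivial).

## Sources

* F.-V. Kuhlmann, Trans. AMS 362 (2010) = arXiv:1003.5678, §4.2, proof of Lemma 4.10 (p. 14).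
-/

noncomputable section

open IsLocalRing Polynomial

namespace Literature.AlgebraicGeometry.Resolution

universe u

variable {Ω : Type u} [Field Ω] (V : ValuationSubring Ω)

/-! ### Polynomial values inside subrings and their residues -/

section Eval

omit V in
/-- `P(c) ∈ T` for a polynomial `P` over a subfield `k`, a subring `T ⊇ k` and `c ∈ T`. [folklore] -/
theorem aeval_mem_subring {k : Subfield Ω} {T : Subring Ω} (hkT : ∀ a ∈ k, a ∈ T) {c : Ω}
    (hc : c ∈ T) (P : Polynomial k) : aeval c P ∈ T := by
  rw [aeval_eq_sum_range]
  refine T.sum_mem fun i _ => ?_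
  rw [Algebra.smul_def]
  exact T.mul_mem (hkT _ (P.coeff i).2) (T.pow_mem hc i)

/-- The inclusion of a subfield `k ⊆ V` into the valuation ring `V`. [folklore] -/
def toValuationSubring (k : Subfield Ω) (hk : ∀ a ∈ k, a ∈ V) : k →+* V :=
  (k.subtype).codRestrict V fun a => hk a a.2

/-- **The residue map on a subfield `k ⊆ V`**, a ring homomorphism `k →+* Ωv` (Kuhlmann 2010,
proof of Lemma 4.10: "We identify this field with `K̄`"). [cite: Kuhlmann2010, Lemma 4.10 (proof)] -/
def residOn (k : Subfield Ω) (hk : ∀ a ∈ k, a ∈ V) : k →+* ResidueField V :=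
  (residue V).comp (toValuationSubring V k hk)

/-- `residOn` is the residue map `resid V` on elements of `k`. [folklore] -/
@[simp]
theorem residOn_apply {k : Subfield Ω} (hk : ∀ a ∈ k, a ∈ V) (a : k) :
    residOn V k hk a = resid V (a : Ω) :=
  (resid_of_mem V (hk a a.2)).symm

/-- `residOn` is injective (a ring homomorphism out of a field). [folklore] -/
theorem residOn_injective {k : Subfield Ω} (hk : ∀ a ∈ k, a ∈ V) :
    Function.Injective (residOn V k hk) :=
  (residOn V k hk).injective

/-- **`P(c)‾ = P̄(c̄)`**: the residue of a polynomial value `P(c)`, `P ∈ k[X]` with `k ⊆ V` and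
`c ∈ V`, is the value at `c̄` of the residue polynomial. [folklore] -/
theorem resid_aeval {k : Subfield Ω} (hk : ∀ a ∈ k, a ∈ V) {c : Ω} (hc : c ∈ V) (P : Polynomial k) :
    resid V (aeval c P) = P.eval₂ (residOn V k hk) (resid V c) := by
  have h1 : aeval c P = ((P.eval₂ (toValuationSubring V k hk) ⟨c, hc⟩ : V) : Ω) := by
    rw [aeval_def, show ((P.eval₂ (toValuationSubring V k hk) ⟨c, hc⟩ : V) : Ω) =
      V.subtype (P.eval₂ (toValuationSubring V k hk) ⟨c, hc⟩) from rfl, hom_eval₂]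
    rfl
  rw [h1, resid_coe, hom_eval₂, resid_of_mem V hc]
  rfl

/-- `P(c) ∈ V` for `P ∈ k[X]`, `k ⊆ V`, `c ∈ V`. [folklore] -/
theorem aeval_mem_valuationSubring {k : Subfield Ω} (hk : ∀ a ∈ k, a ∈ V) {c : Ω} (hc : c ∈ V)
    (P : Polynomial k) : aeval c P ∈ V :=
  aeval_mem_subring (T := V.toSubring) hk hc P

/-- On a subfield `k ⊆ V` the valuation is trivial: non-zero elements have value `1`. [folklore] -/
theorem valuation_eq_one_of_subset {k : Subfield Ω} (hk : ∀ a ∈ k, a ∈ V) {a : Ω} (ha : a ∈ k)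
    (ha0 : a ≠ 0) : V.valuation a = 1 := by
  have h1 : V.valuation a ≤ 1 := (V.valuation_le_one_iff a).mpr (hk a ha)
  have h2 : V.valuation a⁻¹ ≤ 1 := (V.valuation_le_one_iff _).mpr (hk _ (k.inv_mem ha))
  rw [map_inv₀] at h2
  have h3 : 1 ≤ V.valuation a := by
    rwa [inv_le_one₀ ((Valuation.pos_iff _).mpr ha0)] at h2
  exact le_antisymm h1 h3

end Eval

/-! ### The criterion `k(c) ⊆ V` -/

section Adjoin

/-- **`k(c) ⊆ V`** as soon as `k ⊆ V`, `c ∈ V`, and every non-zero polynomial value `P(c)`,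
`P ∈ k[X]`, has value `1` (then `P(c)/Q(c) ∈ V`). [folklore] -/
theorem adjoin_simple_subset_of_valuation_aeval {k : Subfield Ω} (hk : ∀ a ∈ k, a ∈ V) {c : Ω}
    (hc : c ∈ V) (hcrit : ∀ P : Polynomial k, aeval c P ≠ 0 → V.valuation (aeval c P) = 1) :
    ∀ z ∈ IntermediateField.adjoin k ({c} : Set Ω), z ∈ V := by
  intro z hz
  obtain ⟨P, Q, rfl⟩ := (IntermediateField.mem_adjoin_simple_iff (F := k) z).mp hz
  by_cases hQ : aeval c Q = 0
  · rw [hQ, div_zero]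
    exact V.zero_mem
  · rw [← V.valuation_le_one_iff, map_div₀, hcrit Q hQ, div_one, V.valuation_le_one_iff]
    exact aeval_mem_valuationSubring V hk hc P

/-- `k(c) ≤ K` for `k ≤ K` and `c ∈ K`. [folklore] -/
theorem adjoin_simple_le_of_mem {k K : Subfield Ω} (hkK : k ≤ K) {c : Ω} (hc : c ∈ K) :
    (IntermediateField.adjoin k ({c} : Set Ω)).toSubfield ≤ K := by
  intro z hz
  obtain ⟨P, Q, rfl⟩ := (IntermediateField.mem_adjoin_simple_iff (F := k) z).mp hz
  exact K.div_mem (aeval_mem_subring (T := K.toSubring) hkK hc P)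
    (aeval_mem_subring (T := K.toSubring) hkK hc Q)

end Adjoin

/-! ### The field of representatives -/

section Representatives

/-- **The prime field of characteristic `p` is trivially valued**: an element `c` of the bottom
subfield of `Ω`, `char Ω = p`, satisfies `c^p = c` (it lies in the fixed field
`(frobenius Ω p).eqLocusField (RingHom.id Ω)` of the Frobenius), so `c = 0` or `v(c)^{p-1} = 1`, i.e.
`vc = 1`; in particular `c ∈ V`. [folklore] -/
theorem mem_valuationSubring_of_mem_bot (p : ℕ) [hp : Fact p.Prime] [CharP Ω p] {c : Ω}
    (hc : c ∈ (⊥ : Subfield Ω)) : c ∈ V := by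
  have hpow : c ^ p = c :=
    (bot_le : (⊥ : Subfield Ω) ≤ (frobenius Ω p).eqLocusField (RingHom.id Ω)) hc
  by_cases h0 : c = 0
  · rw [h0]
    exact V.zero_mem
  · rw [← V.valuation_le_one_iff]
    have h1 : c ^ (p - 1) = 1 := by
      have h2 : c ^ (p - 1 + 1) = c * 1 := by
        rw [Nat.sub_add_cancel hp.out.one_lt.le, hpow, mul_one]
      rw [pow_succ'] at h2
      exact mul_left_cancel₀ h0 h2
    have h3 : V.valuation c ^ (p - 1) = 1 := by
      rw [← map_pow, h1, map_one]
    have hp1 : p - 1 ≠ 0 := by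
      have := hp.out.two_le
      omega
    rcases lt_trichotomy (V.valuation c) 1 with hlt | heq | hgt
    · exact absurd h3 (pow_lt_one' hlt hp1).ne
    · exact heq.le
    · exact absurd h3 (one_lt_pow' hgt hp1).ne'

/-- **A field of representatives for `K̄` inside an algebraically closed valued subfield `K`**
(Kuhlmann 2010, proof of Lemma 4.10, p. 14: "Since `K` is assumed to be henselian and perfect,
it contains a field of representatives for the residue field `K̄` (we leave the easy proof to
the reader)"; here for `K` algebraically closed, the case in which Lemma 4.10 is vendored, and
`char Ω = p > 0`): there is a subfield `k ≤ K` with `k ⊆ V` (so that the residue map is an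
isomorphism of `k` onto its image) whose residues are all of `K̄ = residueSubfield K V`.
PROVED (Zorn's lemma on the subfields `k ≤ K` with `k ⊆ V`, starting from the prime field; a
maximal one acquires every residue: transcendental residues by the Gauss bound, algebraic ones
through a root in `K` of a lift of the minimal polynomial). [cite: Kuhlmann2010, Lemma 4.10 (proof, p. 14)] -/
theorem exists_subfield_of_representatives (p : ℕ) [hp : Fact p.Prime] [CharP Ω p]
    {K : Subfield Ω} (hK : IsAlgClosed K) :
    ∃ k : Subfield Ω, k ≤ K ∧ (∀ a ∈ k, a ∈ V) ∧
      ∀ r ∈ residueSubfield K V, ∃ a ∈ k, resid V a = r := by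
  classical
  set S : Set (Subfield Ω) := {k | k ≤ K ∧ ∀ a ∈ k, a ∈ V} with hS
  -- Zorn's lemma
  have hbot : (⊥ : Subfield Ω) ∈ S :=
    ⟨bot_le, fun c hc => mem_valuationSubring_of_mem_bot V p hc⟩
  have hchain : ∀ c ⊆ S, IsChain (· ≤ ·) c → ∀ y ∈ c, ∃ ub ∈ S, ∀ z ∈ c, z ≤ ub := by
    intro c hcS hc y hy
    refine ⟨sSup c, ⟨sSup_le fun k hk => (hcS hk).1, fun a ha => ?_⟩, fun z hz => le_sSup hz⟩
    obtain ⟨k, hk, hak⟩ := (Subfield.mem_sSup_of_directedOn ⟨y, hy⟩ hc.directedOn).mp ha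
    exact (hcS hk).2 a hak
  obtain ⟨k, -, hkmax⟩ := zorn_le_nonempty₀ S hchain ⊥ hbot
  have hkK : k ≤ K := hkmax.prop.1
  have hkV : ∀ a ∈ k, a ∈ V := hkmax.prop.2
  refine ⟨k, hkK, hkV, fun r hr => ?_⟩
  -- maximality: an element `c ∈ K ∩ V` satisfying the criterion lies in `k`
  have hmax : ∀ c ∈ K, c ∈ V →
      (∀ P : Polynomial k, aeval c P ≠ 0 → V.valuation (aeval c P) = 1) → c ∈ k := by
    intro c hcK hcV hcrit
    set k' : Subfield Ω := (IntermediateField.adjoin k ({c} : Set Ω)).toSubfield with hk'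
    have hk'S : k' ∈ S := ⟨adjoin_simple_le_of_mem hkK hcK,
      fun z hz => adjoin_simple_subset_of_valuation_aeval V hkV hcV hcrit z hz⟩
    have hle : k ≤ k' := fun z hz =>
      (IntermediateField.adjoin k ({c} : Set Ω)).algebraMap_mem ⟨z, hz⟩
    have heq : k' = k := hkmax.eq_of_ge hk'S hle
    have hck' : c ∈ k' := IntermediateField.mem_adjoin_simple_self k c
    rwa [heq] at hck'
  -- the residue field `k̄` and the isomorphism `k ≅ k̄`
  set kbar : Subfield (ResidueField V) := residueSubfield k V with hkbar
  set θ : k →+* kbar := (residOn V k hkV).codRestrict kbar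
    fun a => by rw [residOn_apply]; exact resid_mem_residueSubfield V a.2 with hθ
  have hθ_comp : (algebraMap kbar (ResidueField V)).comp θ = residOn V k hkV :=
    RingHom.ext fun _ => rfl
  have hθinj : Function.Injective θ := θ.injective
  -- residues of polynomial values, through `θ`
  have hres : ∀ {c : Ω} (hc : c ∈ V) (P : Polynomial k),
      resid V (aeval c P) = aeval (resid V c) (P.map θ) := by
    intro c hc P
    rw [resid_aeval V hkV hc, aeval_def, eval₂_map, hθ_comp]
  -- a lift `a ∈ K ∩ V` of `r`
  obtain ⟨a, haK, haV, har⟩ := exists_resid_eq_of_mem_residueSubfield V hr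
  by_cases halg : IsAlgebraic kbar r
  · -- ALGEBRAIC residue: lift the minimal polynomial and take a root in `K` of residue `r`
    have hθsurj : Function.Surjective θ := by
      rintro ⟨r', hr'⟩
      obtain ⟨b, hbk, -, hbr⟩ := exists_resid_eq_of_mem_residueSubfield V hr'
      refine ⟨⟨b, hbk⟩, Subtype.ext ?_⟩
      change residOn V k hkV ⟨b, hbk⟩ = r'
      rw [residOn_apply]
      exact hbr
    set e : k ≃+* kbar := RingEquiv.ofBijective θ ⟨hθinj, hθsurj⟩ with he
    have hint : IsIntegral kbar r := halg.isIntegral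
    set gbar : Polynomial kbar := minpoly kbar r with hgbar
    set g : Polynomial k := gbar.map (e.symm : kbar →+* k) with hg
    have hgmonic : g.Monic := (minpoly.monic hint).map _
    have hg_map : g.map θ = gbar := by
      rw [hg, Polynomial.map_map]
      have hcomp : θ.comp (e.symm : kbar →+* k) = RingHom.id kbar := by
        refine RingHom.ext fun x => ?_
        change θ (e.symm x) = x
        have h1 := e.apply_symm_apply x
        rwa [he, RingEquiv.ofBijective_apply] at h1
      rw [hcomp, Polynomial.map_id]
    have hdeg_g : g.degree = gbar.degree := by
      rw [hg, degree_map_eq_of_injective (e.symm : kbar →+* k).injective]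
    -- `g(c)‾ = ḡ(c̄)`; in particular `v(g(c)) < 1` when `c̄ = r`
    have hres_g : ∀ {c : Ω} (hc : c ∈ V), resid V (aeval c g) = aeval (resid V c) gbar := by
      intro c hc
      rw [hres hc, hg_map]
    -- roots of `g` in `K`
    haveI := hK
    set gK : Polynomial K := g.map (Subfield.inclusion hkK) with hgK
    have hgKmonic : gK.Monic := hgmonic.map _
    have hsplit : gK.Splits := IsAlgClosed.splits gK
    have heval : ∀ x : K, ((gK.eval x : K) : Ω) = aeval (x : Ω) g := by
      intro x
      rw [hgK, eval_map, show ((g.eval₂ (Subfield.inclusion hkK) x : K) : Ω) =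
        K.subtype (g.eval₂ (Subfield.inclusion hkK) x) from rfl, hom_eval₂, aeval_def]
      rfl
    -- the roots lie in `V`
    have hv : V.valuation.Integers V := by
      have h := Valuation.valuationSubring.integers (v := V.valuation)
      rwa [ValuationSubring.valuationSubring_valuation] at h
    have hrootV : ∀ ρ ∈ gK.roots, (ρ : Ω) ∈ V := by
      intro ρ hρ
      have hρ0 : aeval (ρ : Ω) g = 0 := by
        have h1 : gK.eval ρ = 0 := (mem_roots hgKmonic.ne_zero).mp hρ
        rw [← heval, h1]
        rfl
      have hint' : IsIntegral V (ρ : Ω) := by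
        refine ⟨g.map (toValuationSubring V k hkV), hgmonic.map _, ?_⟩
        rw [eval₂_map]
        rw [aeval_def] at hρ0
        exact hρ0
      rw [← V.valuation_le_one_iff]
      exact (hv.isIntegral_iff_v_le_one).mp hint'
    -- some root has residue `r`
    have hexists : ∃ ρ ∈ gK.roots, resid V (ρ : Ω) = r := by
      by_contra hne
      push Not at hne
      set aK : K := ⟨a, haK⟩ with haK'
      have hprod : gK.eval aK = (gK.roots.map fun ρ => aK - ρ).prod :=
        hsplit.eval_eq_prod_roots_of_monic hgKmonic aK
      -- each factor `a - ρ` has value `1`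
      have hfac : ∀ ρ ∈ gK.roots, V.valuation ((a : Ω) - (ρ : Ω)) = 1 := by
        intro ρ hρ
        have hmem : (a : Ω) - (ρ : Ω) ∈ V := V.sub_mem haV (hrootV ρ hρ)
        rw [← resid_ne_zero_iff V hmem, resid_sub V haV (hrootV ρ hρ), har, sub_ne_zero]
        exact fun h => hne ρ hρ h.symm
      have hval1 : V.valuation (aeval a g) = 1 := by
        have h1 : aeval a g = ((gK.eval aK : K) : Ω) := (heval aK).symm
        rw [h1, hprod, show (((gK.roots.map fun ρ => aK - ρ).prod : K) : Ω) =
          K.subtype ((gK.roots.map fun ρ => aK - ρ).prod) from rfl, map_multiset_prod,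
          map_multiset_prod, Multiset.map_map, Multiset.map_map]
        refine Multiset.prod_eq_one fun x hx => ?_
        obtain ⟨ρ, hρ, rfl⟩ := Multiset.mem_map.mp hx
        change V.valuation (K.subtype (aK - ρ)) = 1
        rw [map_sub]
        exact hfac ρ hρ
      -- but `g(a)‾ = ḡ(r) = 0`
      have hval2 : V.valuation (aeval a g) < 1 := by
        rw [← resid_eq_zero_iff V (aeval_mem_valuationSubring V hkV haV g), hres_g haV, har,
          hgbar, minpoly.aeval]
      exact hval2.ne hval1
    obtain ⟨ρ, hρ, hρr⟩ := hexists
    have hρV : (ρ : Ω) ∈ V := hrootV ρ hρ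
    have hgρ : aeval (ρ : Ω) g = 0 := by
      have h1 : gK.eval ρ = 0 := (mem_roots hgKmonic.ne_zero).mp hρ
      rw [← heval, h1]
      rfl
    -- the criterion for `ρ`: `m(ρ) ≠ 0`, `deg m < deg g` ⇒ `m̄(r) ≠ 0`
    refine ⟨ρ, hmax ρ ρ.2 hρV fun P hP => ?_, hρr⟩
    set m : Polynomial k := P %ₘ g with hm
    have hmP : aeval (ρ : Ω) m = aeval (ρ : Ω) P := aeval_modByMonic_eq_self_of_root hgρ
    rw [← hmP] at hP ⊢
    have hm0 : m ≠ 0 := by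
      rintro h0
      rw [h0, map_zero] at hP
      exact hP rfl
    have hdeg : (m.map θ).degree < gbar.degree := by
      rw [degree_map_eq_of_injective hθinj, ← hdeg_g]
      exact degree_modByMonic_lt P hgmonic
    rw [← resid_ne_zero_iff V (aeval_mem_valuationSubring V hkV hρV m), hres hρV, hρr]
    intro h0
    have hne : m.map θ ≠ 0 := (Polynomial.map_ne_zero_iff hθinj).mpr hm0
    exact not_le.mpr hdeg (minpoly.degree_le_of_ne_zero kbar r hne h0)
  · -- TRANSCENDENTAL residue: `a` itself works, by the Gauss bound
    refine ⟨a, hmax a haK haV fun P hP => ?_, har⟩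
    have hP0 : P ≠ 0 := by
      rintro rfl
      rw [map_zero] at hP
      exact hP rfl
    rw [← resid_ne_zero_iff V (aeval_mem_valuationSubring V hkV haV P), hres haV, har]
    intro h0
    exact halg ⟨P.map θ, (Polynomial.map_ne_zero_iff hθinj).mpr hP0, h0⟩

end Representatives

end Literature.AlgebraicGeometry.Resolution
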